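import Summits.CriticalPhenomena.Ising3DConformalLimit.Theorems.AnomalousForcesInteractionGaussianLimitIsFreeCondIndepCovariance
import Summits.CriticalPhenomena.Ising3DConformalLimit.Theorems.AnomalousForcesInteractionGaussianLimitIsFreeSobolevRieszDuality
import Summits.CriticalPhenomena.Ising3DConformalLimit.Theorems.AnomalousForcesInteractionGaussianLimitIsFreeCollarCutoff
import Summits.CriticalPhenomena.Ising3DConformalLimit.Theorems.AnomalousForcesInteractionGaussianLimitIsFreeGaussianCondExpSqLe
import HarnessLib

/-!
# Crux `GaussianLimitIsFree` (item stmt-CriticalPhenomena-2601), line `registered` (birth v6):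
# the covariance across the unit sphere vanishes for a germ-Markov Gaussian law (lead c3)

THEOREM-ONLY file, part 2 of the glue of the direct germ-form rigidity proof of stub 3
(`stub_gaussMarkovRigidity`) of `Cruxes/GaussianLimitIsFree/Lines/birth.lean`.

`twoPoint_eq_zero_of_germMarkov_ball` / `stub_sphere_covariance_zero` (registered form): let `μ` be a
centred Gaussian probability law on `𝒮'(ℝ³)` with two-point function `A · K_Δ`,
`K_Δ(u,v) = ∫∫ u(x)‖x−y‖^{-2Δ}v(y)`, `A > 0`, `1/2 < Δ ≤ 1`, for which the germ σ-algebra of the unit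
sphere splits those of the closed unit ball and of the complement of the open unit ball (Kotani's
Def. 1 / Rozanov's (3.14) at `ball 0 1`); if `w` is supported in the open ball and its Riesz potential
vanishes on the sphere, then `E[ω(w) ω(v)] = 0` for every `v` supported outside the closed ball.
Proof: `|E[ω w ω v]| ≤ ‖E[ω w | 𝒢]‖₂ ‖ω v‖₂` (`abs_integral_mul_le_of_condIndepCondExp`, part 1), and
`‖E[ω w | 𝒢]‖₂ ≤ η` for every `η > 0` by the Gaussian conditional-expectation bound
`stub_gaussian_condExp_sq_le` applied on the thin collars `(∂B)^ε`, where the covariance of `ω w`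
with the collar field is small by `stub_collar_cutoff` (cutoff of the potential, `H¹`-small) and
`stub_sobolev_riesz_duality` (`|∫ h f| ≤ C ‖h‖_{H¹} K_Δ(f,f)^{1/2}`).

References: Yu. A. Rozanov, *Markov Random Fields* (1982), Ch. 2 §3.1, Ch. 3 §2.3; L. D. Pitt, ARMA 43
(1971); S. Kotani, LNM 330 (1973).
-/

noncomputable section

namespace Summit.CriticalPhenomena.Ising3DConformalLimit.Cruxes.GaussianLimitIsFree.Birth

open MeasureTheory Filter Set
open scoped ProbabilityTheory Topology ENNReal
open Literature.MathematicalPhysics.QuantumLattice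

section Field

open scoped SchwartzMap


/-- `tsupport (u₁ - c • u₂) ⊆ tsupport u₁ ∪ tsupport u₂` for Schwartz functions, in the form needed:
if both are supported in a closed set `S`, so is the combination. [folklore] -/
theorem tsupport_sub_smul_subset {u₁ u₂ : 𝓢((EuclideanSpace ℝ (Fin 3)), ℝ)} {S : Set (EuclideanSpace ℝ (Fin 3))} (hS : IsClosed S)
    (h₁ : tsupport ⇑u₁ ⊆ S) (h₂ : tsupport ⇑u₂ ⊆ S) (c : ℝ) :
    tsupport ⇑(u₁ - c • u₂) ⊆ S := by
  refine closure_minimal (fun x hx => ?_) hS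
  rw [Function.mem_support] at hx
  by_contra hxS
  have e1 : u₁ x = 0 := image_eq_zero_of_notMem_tsupport (fun h => hxS (h₁ h))
  have e2 : u₂ x = 0 := image_eq_zero_of_notMem_tsupport (fun h => hxS (h₂ h))
  apply hx
  simp [e1, e2]

/-- Elementary: a nonnegative real which is `≤ η · b` for every `η > 0` (`b` fixed) vanishes. [folklore] -/
theorem eq_zero_of_forall_le_mul {a b : ℝ} (ha : 0 ≤ a) (h : ∀ η : ℝ, 0 < η → a ≤ η * b) : a = 0 := by
  by_contra hne
  have hapos : 0 < a := lt_of_le_of_ne ha (Ne.symm hne)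
  have hb : 0 < b := by
    have := h 1 one_pos
    nlinarith
  have := h (a / (2 * b)) (by positivity)
  have e : a / (2 * b) * b = a / 2 := by field_simp
  rw [e] at this
  linarith

/-- **Vanishing covariance across the sphere.**  Let `μ` be a centred Gaussian probability law on
`𝒮'(ℝ³)` with two-point function `E[ω(u)ω(v)] = A · K_Δ(u,v)`, `K_Δ(u,v) = ∫∫ u(x)‖x−y‖^{-2Δ}v(y)`,
`A > 0`, `1/2 < Δ ≤ 1`, such that the germ σ-algebra of the unit sphere splits those of the closed unit
ball and of the complement of the open unit ball ((K) at `ball 0 1`).  If `w` is supported in the open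
ball and its Riesz potential vanishes on the sphere, then `E[ω(w)ω(v)] = 0` for every `v` supported
outside the closed ball.  Inputs: the Gaussian conditional-expectation bound `stub_gaussian_condExp_sq_le`,
the Sobolev–Riesz duality `stub_sobolev_riesz_duality` and the thin-collar cutoff `stub_collar_cutoff` (tree
theorems, stubs 3.1–3.3 of the skeleton) and the covariance bound of part 1. [cite: Rozanov1982, Ch. 3 §2.3 Theorem (p. 115)] -/
theorem twoPoint_eq_zero_of_germMarkov_ball
    {Δ A : ℝ} (hΔ : 1 / 2 < Δ) (hΔ1 : Δ ≤ 1) (hA : 0 < A)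
    {μ : Measure (FieldConfig (EuclideanSpace ℝ (Fin 3)))} [IsProbabilityMeasure μ] (hG : IsGaussianField μ)
    (h2pt : ∀ u v : 𝓢((EuclideanSpace ℝ (Fin 3)), ℝ), twoPoint μ u v = A * ∫ x, ∫ y, u x * ‖x - y‖ ^ (-(2 * Δ)) * v y)
    (hK : CondIndepCondExp (germSigma (frontier (Metric.ball (0 : (EuclideanSpace ℝ (Fin 3))) 1)))
      (germSigma (closure (Metric.ball (0 : (EuclideanSpace ℝ (Fin 3))) 1))) (germSigma (Metric.ball (0 : (EuclideanSpace ℝ (Fin 3))) 1)ᶜ) μ)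
    {w : 𝓢((EuclideanSpace ℝ (Fin 3)), ℝ)} (hw : tsupport ⇑w ⊆ Metric.ball (0 : (EuclideanSpace ℝ (Fin 3))) 1)
    (hws : ∀ x : (EuclideanSpace ℝ (Fin 3)), ‖x‖ = 1 → ∫ y, w y * ‖y - x‖ ^ (-(2 * Δ)) = 0)
    {v : 𝓢((EuclideanSpace ℝ (Fin 3)), ℝ)} (hv : tsupport ⇑v ⊆ (Metric.closedBall (0 : (EuclideanSpace ℝ (Fin 3))) 1)ᶜ) :
    twoPoint μ w v = 0 := by
  -- the three σ-algebras of (K) at the unit ball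
  have hfr : frontier (Metric.ball (0 : (EuclideanSpace ℝ (Fin 3))) 1) = Metric.sphere 0 1 := frontier_ball (0 : (EuclideanSpace ℝ (Fin 3))) one_ne_zero
  have hcl : closure (Metric.ball (0 : (EuclideanSpace ℝ (Fin 3))) 1) = Metric.closedBall 0 1 := closure_ball (0 : (EuclideanSpace ℝ (Fin 3))) one_ne_zero
  have hfr_sub : frontier (Metric.ball (0 : (EuclideanSpace ℝ (Fin 3))) 1) ⊆ (Metric.ball (0 : (EuclideanSpace ℝ (Fin 3))) 1)ᶜ := by
    rw [Metric.isOpen_ball.frontier_eq]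
    exact fun x hx => hx.2
  have hle : germSigma (frontier (Metric.ball (0 : (EuclideanSpace ℝ (Fin 3))) 1)) ≤ germSigma (Metric.ball (0 : (EuclideanSpace ℝ (Fin 3))) 1)ᶜ :=
    germSigma_mono hfr_sub
  -- measurability of the two evaluations
  have hXm : Measurable[germSigma (closure (Metric.ball (0 : (EuclideanSpace ℝ (Fin 3))) 1))] (fun ω : FieldConfig (EuclideanSpace ℝ (Fin 3)) => ω w) :=
    (measurable_eval_fieldSigma hw).mono
      ((fieldSigma_mono subset_closure).trans (fieldSigma_le_germSigma _)) le_rfl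
  have hv' : tsupport ⇑v ⊆ (closure (Metric.ball (0 : (EuclideanSpace ℝ (Fin 3))) 1))ᶜ := by rwa [hcl]
  have hYm : Measurable[germSigma (Metric.ball (0 : (EuclideanSpace ℝ (Fin 3))) 1)ᶜ] (fun ω : FieldConfig (EuclideanSpace ℝ (Fin 3)) => ω v) :=
    (measurable_eval_fieldSigma hv').mono
      ((fieldSigma_mono (Set.compl_subset_compl.2 subset_closure)).trans (fieldSigma_le_germSigma _))
      le_rfl
  have hX2 := memLp_two_eval_of_isGaussianField hG w
  have hY2 := memLp_two_eval_of_isGaussianField hG v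
  -- the covariance bound from the splitting
  have hbound := abs_integral_mul_le_of_condIndepCondExp (germSigma_le _) (germSigma_le _)
    (germSigma_le _) hle hK hXm.stronglyMeasurable.aestronglyMeasurable hYm.stronglyMeasurable hX2 hY2
  -- the conditional expectation of `ω w` given the germ of the sphere is small in `L²`
  obtain ⟨C, hC, hdual⟩ := stub_sobolev_riesz_duality Δ hΔ hΔ1
  have hsmall : ∀ η : ℝ, 0 < η →
      Real.sqrt (∫ ω, (μ[(fun ω : FieldConfig (EuclideanSpace ℝ (Fin 3)) => ω w) |
        germSigma (frontier (Metric.ball (0 : (EuclideanSpace ℝ (Fin 3))) 1))]) ω ^ 2 ∂μ) ≤ η := by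
    intro η hη
    have hAC : 0 < Real.sqrt A * C := mul_pos (Real.sqrt_pos.2 hA) hC
    set η₅ : ℝ := (η / (Real.sqrt A * C)) ^ 2 with hη₅
    have hη₅pos : 0 < η₅ := by positivity
    obtain ⟨ε, hε, h, hhK, hhnorm⟩ := stub_collar_cutoff Δ hΔ hΔ1 w hw hws η₅ hη₅pos
    -- hypothesis of `stub_gaussian_condExp_sq_le` on the collar
    have hP : ∀ f : 𝓢((EuclideanSpace ℝ (Fin 3)), ℝ), tsupport ⇑f ⊆ Metric.thickening ε (Metric.sphere (0 : (EuclideanSpace ℝ (Fin 3))) 1) →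
        |∫ ω, ω w * ω f ∂μ| ≤ η * Real.sqrt (∫ ω, (ω f) ^ 2 ∂μ) := by
      intro f hf
      have e1 : ∫ ω, ω w * ω f ∂μ = A * ∫ x, h x * f x := by
        rw [← hhK f hf, ← h2pt w f]
        rfl
      have e2 : ∫ ω, (ω f) ^ 2 ∂μ = A * ∫ x, ∫ y, f x * ‖x - y‖ ^ (-(2 * Δ)) * f y := by
        rw [← h2pt f f]
        simp only [twoPoint, sq]
      rw [e1, e2, abs_mul, abs_of_pos hA, Real.sqrt_mul hA.le]
      have hd := hdual h f
      have hs : Real.sqrt ((∫ x, (h x) ^ 2) + ∫ x, ‖fderiv ℝ (⇑h) x‖ ^ 2) ≤ η / (Real.sqrt A * C) := by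
        calc Real.sqrt ((∫ x, (h x) ^ 2) + ∫ x, ‖fderiv ℝ (⇑h) x‖ ^ 2) ≤ Real.sqrt η₅ :=
              Real.sqrt_le_sqrt hhnorm
          _ = η / (Real.sqrt A * C) := by
              rw [hη₅, Real.sqrt_sq (by positivity)]
      have hKnn : 0 ≤ Real.sqrt (∫ x, ∫ y, f x * ‖x - y‖ ^ (-(2 * Δ)) * f y) := Real.sqrt_nonneg _
      calc A * |∫ x, h x * f x|
          ≤ A * (C * Real.sqrt ((∫ x, (h x) ^ 2) + ∫ x, ‖fderiv ℝ (⇑h) x‖ ^ 2) *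
              Real.sqrt (∫ x, ∫ y, f x * ‖x - y‖ ^ (-(2 * Δ)) * f y)) :=
            mul_le_mul_of_nonneg_left hd hA.le
        _ ≤ A * (C * (η / (Real.sqrt A * C)) *
              Real.sqrt (∫ x, ∫ y, f x * ‖x - y‖ ^ (-(2 * Δ)) * f y)) := by
            gcongr
        _ = η * (Real.sqrt A * Real.sqrt (∫ x, ∫ y, f x * ‖x - y‖ ^ (-(2 * Δ)) * f y)) := by
            have hsA : Real.sqrt A ≠ 0 := (Real.sqrt_pos.2 hA).ne'
            have hCne : C ≠ 0 := hC.ne'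
            have hdiv : A / Real.sqrt A = Real.sqrt A := Real.div_sqrt
            rw [← hdiv]
            field_simp
            rw [Real.sq_sqrt hA.le]
    have hGle : germSigma (frontier (Metric.ball (0 : (EuclideanSpace ℝ (Fin 3))) 1)) ≤
        fieldSigma (Metric.thickening ε (Metric.sphere (0 : (EuclideanSpace ℝ (Fin 3))) 1)) := by
      rw [hfr]
      exact germSigma_le_fieldSigma_thickening _ hε
    have h31' := stub_gaussian_condExp_sq_le μ hG
      (Metric.thickening ε (Metric.sphere (0 : (EuclideanSpace ℝ (Fin 3))) 1)) w η hη.le hP _ hGle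
    calc Real.sqrt (∫ ω, (μ[(fun ω : FieldConfig (EuclideanSpace ℝ (Fin 3)) => ω w) |
            germSigma (frontier (Metric.ball (0 : (EuclideanSpace ℝ (Fin 3))) 1))]) ω ^ 2 ∂μ)
        ≤ Real.sqrt (η ^ 2) := Real.sqrt_le_sqrt h31'
      _ = η := Real.sqrt_sq hη.le
  -- conclude
  have habs : |∫ ω, ω w * ω v ∂μ| = 0 := by
    refine eq_zero_of_forall_le_mul (b := Real.sqrt (∫ ω, (ω v) ^ 2 ∂μ)) (abs_nonneg _) fun η hη => ?_
    exact hbound.trans (mul_le_mul_of_nonneg_right (hsmall η hη) (Real.sqrt_nonneg _))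
  have : ∫ ω, ω w * ω v ∂μ = 0 := abs_eq_zero.1 habs
  simpa [twoPoint] using this

end Field

/-- **Registered form (crux stmt-CriticalPhenomena-2601, skeleton v6, sub-goal of the glue): the covariance
across the unit sphere vanishes** — see `twoPoint_eq_zero_of_germMarkov_ball` (all arguments explicit).
[cite: Rozanov1982, Ch. 3 §2.3 Theorem (p. 115)] -/
theorem stub_sphere_covariance_zero :
    ∀ (Δ A : ℝ) (μ : MeasureTheory.Measure (Literature.MathematicalPhysics.QuantumLattice.FieldConfig (EuclideanSpace ℝ (Fin 3))))
      [MeasureTheory.IsProbabilityMeasure μ], 1 / 2 < Δ → Δ ≤ 1 → 0 < A →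
      Literature.MathematicalPhysics.QuantumLattice.IsGaussianField μ →
      (∀ u v : SchwartzMap (EuclideanSpace ℝ (Fin 3)) ℝ, Literature.MathematicalPhysics.QuantumLattice.twoPoint μ u v =
        A * ∫ x, ∫ y, u x * ‖x - y‖ ^ (-(2 * Δ)) * v y) →
      Literature.MathematicalPhysics.QuantumLattice.CondIndepCondExp
        (Literature.MathematicalPhysics.QuantumLattice.germSigma (frontier (Metric.ball (0 : EuclideanSpace ℝ (Fin 3)) 1)))
        (Literature.MathematicalPhysics.QuantumLattice.germSigma (closure (Metric.ball (0 : EuclideanSpace ℝ (Fin 3)) 1)))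
        (Literature.MathematicalPhysics.QuantumLattice.germSigma (Metric.ball (0 : EuclideanSpace ℝ (Fin 3)) 1)ᶜ) μ →
      ∀ (w : SchwartzMap (EuclideanSpace ℝ (Fin 3)) ℝ), tsupport ⇑w ⊆ Metric.ball (0 : EuclideanSpace ℝ (Fin 3)) 1 →
        (∀ x : EuclideanSpace ℝ (Fin 3), ‖x‖ = 1 → ∫ y, w y * ‖y - x‖ ^ (-(2 * Δ)) = 0) →
        ∀ (v : SchwartzMap (EuclideanSpace ℝ (Fin 3)) ℝ),
          tsupport ⇑v ⊆ (Metric.closedBall (0 : EuclideanSpace ℝ (Fin 3)) 1)ᶜ →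
          Literature.MathematicalPhysics.QuantumLattice.twoPoint μ w v = 0 := by
  intro Δ A μ _ hΔ hΔ1 hA hG h2pt hK w hw hws v hv
  exact twoPoint_eq_zero_of_germMarkov_ball hΔ hΔ1 hA hG h2pt hK hw hws hv

end Summit.CriticalPhenomena.Ising3DConformalLimit.Cruxes.GaussianLimitIsFree.Birth

end
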